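/-
Copyright (c) 2026 the pub-hodgecm-mathlib formalisation cell (harness21).  Prover seat hodgecm-mathlib-K2E1-p10 (g5), Track B «K2-LIT», h413 = `stmt-HodgeConjecture-24833`,
R90-TF section S8 «ContSpec-n½», deal S8-R195 (i) §3 ∕ rulings S8-R197 (J-S8-ADM: (O3)-as-letter `hW1`) and S8-R199 (J-S8-ADM′: τ-admissible): (R)′ OF RECORD (★ p863946
`res_midBlock_le_residual_of_record`) RE-RUN OVER ADMISSIBLE GENERATORS ONLY — the ∀-rows restricted to the generators satisfying an admissibility predicate `Adm`, at the price
of ONE letter `hW1` («the admissible generators generate the middle block»); the structural step is that `(L²_cusp)ᗮ` is a closed invariant subspace of the unitary `R`.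
-/
import Summits.HodgeConjecture.HodgeConjecture.Theorems.R90S8ResGMidBlockLeResidualOfRecordU3       -- ★ p863946 (K2E1-p12): (R)′ OF RECORD + `scalPackage_of_inputs`; its imports carry the whole (R)′ engine
import HarnessLib

/-!
# S8 sub-socket (R)′ — `R90S8ResGMidBlockLeResidualOfAdmissibleU3`: THE MIDDLE BLOCK IS RESIDUAL, FROM ROWS AT ADMISSIBLE GENERATORS ONLY + THE LETTER `hW1`

Track B ∕ R90-TF, crux h413 = `stmt-HodgeConjecture-24833`, route `HCCMUnconditional`; cell `hodgecm-mathlib`, S8 «ContSpec-n½», sub-socket (R) `sock_S8_res_midBlock_le_residual` ((R)′, B ED. 7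
:337); deal S8-R195 (i) §3, rulings S8-R197 (J-S8-ADM) and S8-R199 (J-S8-ADM′).  THEOREMS ONLY (no `def`∕`instance`∕`notation`, no named-fact hypothesis, no `sorry`, default heartbeats);
lane `--supports … --as helper`; CLOSES NO SOCKET.  THE STRUCTURAL FINDING F1 (K2E1-p10, 01:10Z): ★ D1's `resGMidBlock ξ μω` is generated by the atoms at EVERY level `(K′, ω)` and
`chiSectionSpacePair` carries no level condition, while every export head in the tree (★ row 8 LEVEL, ★ `chiPair_exports_of_witness[_with_truncatedFamily]`) pays an ADMISSIBLE
level package — so the ∀-rows `hCONT hEXP hSCALrows hSCATrows` of ★ (R)′ OF RECORD are not dischargeable by instantiation as typed.  RULING (O3)-AS-ONE-LETTER: restrict the rows to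
ADMISSIBLE generators and carry `hW1 : resGMidBlock ≤ closed invariant hull of the admissible generators` (true in print: `K`-finite residues generate [MW95 I.2.17, II.1, V.3.13]).
THIS FILE is that re-run, GENERIC IN THE ADMISSIBILITY PREDICATE `Adm K′ ω φ` (so that τ-admissible (S8-R199: `K′ = ι_f(U₀)`, `ω = 1`, `φ` `K_∞`-finite), 1-dim-admissible (S8-R197),
or their union — whose rows then SPLIT into a dischargeable part and the letter `hEXPτ` of ESTATE T — all bind it BY NAME with their own `Adm`):
* §1 HEAD **`res_midBlock_le_residual_of_admissible`** — binders: the socket frame `(L μ 𝔓 h𝔓 hne μω hμu hquad ξ)` of :337 verbatim (+ Borel structures); `Adm`; L1 `hDISC` verbatim;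
  **`hW1`** (the generating set = D1's generator clauses VERBATIM with `(_ : Adm K′ ω φ)` inserted after `φ`); then ★ (R)′ OF RECORD's rows `hCONT`, `hEXP`, the F5 block (once,
  verbatim), `hSCALrows`, `hSCATrows` — EACH WITH `(_ : Adm K′ ω φ)` INSERTED AFTER `φ` and otherwise byte-identical.  Conclusion: `resGMidBlock L μ ξ μω ≤ residualSubspace … μ 𝔓`.
  PROOF: `L²_res = L²_disc ⊓ (L²_cusp)ᗮ` (★ `mem_residualPart_iff`); the disc half for the whole block is L1 (★ `resGMidBlock_le_discreteSpectrum_of_admissible`); the cusp half: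
  `(L²_cusp)ᗮ` is a CLOSED INVARIANT subspace of the unitary right-regular representation (★ `ClosedSubrep.orthogonal`), so by ★ `ClosedSubrep.generate_le` and `hW1` it suffices
  that every ADMISSIBLE generator `f` is orthogonal to `L²_cusp` — which is ★ (R)′ OF RECORD's per-generator spine verbatim (rows at the normalised Heisenberg package ⟶ ★
  `roadData_of_tubeLetters` ⟶ ★ `scalPackage_of_inputs` ⟶ ★ `ctPackage_of_scalarRoad` ⟶ ★ `opRoadPackage_of_letters`) closed by ★ `hseed_of_resGMidAtomGen_clauses`, ★
  `inner_cuspFormsToLp_eq_zero_of_midResidue_letters`, ★ `inner_eq_zero_of_mem_cuspidalSubspace_of_forall_cuspFormsToLp`.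
HONEST LABEL: HC_CM is proved only modulo the 7 printed citations (2 remaining named inputs: hLiu418 = `stmt-HodgeConjecture-24832`, h413 = `stmt-HodgeConjecture-24833`) until
rung 0 closes; REL ≠ ★ ≠ BUILT; composition, not payment: conditional by construction on `hDISC`, `hW1` and the admissible rows it names; closes no socket; count-neutral.

## References
* [MoeglinWaldspurger1995] C. Mœglin, J.-L. Waldspurger, *Spectral Decomposition and Eisenstein Series* (1995), I.2.17, I.2.18, II.1, IV.1.9–IV.1.11, IV.2.3, V.3.13.
* [Langlands1976] R. P. Langlands, *On the Functional Equations Satisfied by Eisenstein Series*, LNM 544 (1976), §7 and Appendix.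
* [Rogawski1990] J. D. Rogawski, *Automorphic Representations of Unitary Groups in Three Variables* (1990), §12.1 p. 171, §13.9 p. 229 (ii).
* [BernsteinLapid2019] J. Bernstein, E. Lapid, *On the meromorphic continuation of Eisenstein series*, J. AMS 37 (2024), §4.
-/

set_option autoImplicit false
set_option linter.dupNamespace false  -- the mandated namespace `…HodgeConjecture.HodgeConjecture.R90.S8` (LEAD #1 L1) repeats the summit's segment

noncomputable section

open MeasureTheory Measure NumberField IsDedekindDomain Set Filter Topology ContRepresentation
open scoped ENNReal NNReal ComplexConjugate InnerProductSpace Topology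
open Literature.NumberTheory Literature.NumberTheory.Automorphic Literature.NumberTheory.Automorphic.UnitaryGroup Literature.NumberTheory.GaloisRepresentations AdelicGroupData
open Literature.NumberTheory.Automorphic.Arthur2013.Leaves.TECR Literature.NumberTheory.Rogawski1990 Literature.NumberTheory.LFunctions
open Summit.HodgeConjecture.HodgeConjecture.Cruxes.H413.K2E1BorelEisensteinU Summit.HodgeConjecture.HodgeConjecture.Cruxes.H413.K2E1CharacterEisensteinU2Defs
open Summit.HodgeConjecture.HodgeConjecture.Cruxes.H413.K2E1CharacterEisensteinU3PairDefs Summit.HodgeConjecture.HodgeConjecture.Cruxes.H413.K2E1ChiSectionSpaceU3PairDefs Summit.HodgeConjecture.HodgeConjecture.Cruxes.H413.K2E1BLBorelSpacesU2Defs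
open Summit.HodgeConjecture.HodgeConjecture.Cruxes.H413.K2E1CuspidalSpectrumUnitary (residualSubspace mem_residualPart_iff)
open Summit.HodgeConjecture.HodgeConjecture.Cruxes.H413.K2E1ChiConstantTermFactorisationContinuedU3 (eventually_factorisation_of_unfolded)
open Summit.HodgeConjecture.HodgeConjecture.Cruxes.H413.K2E1ChiConstantTermHolomorphicCMThree (differentiableOn_middleCoefficient_slitPlane_cm_three)
open Summit.HodgeConjecture.HodgeConjecture.Cruxes.H413.K2E1ChiScatteringMiddlePoleU3 (exists_residue_at_threeHalves_cm_three)
open Summit.HodgeConjecture.HodgeConjecture.Cruxes.H413.K2E1SphericalEisensteinResidueConstantCMThreeOfLetters (exists_analyticAt_eventuallyEq_mul_sub_of_tendsto)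
open Summit.HodgeConjecture.HodgeConjecture.Cruxes.H413.R90S8ResGMidBlockScatteringOfRecordU3 (exists_hSCAT_of_factorisation integrable_restrict_mul_conj_of_bounded)

namespace Summit.HodgeConjecture.HodgeConjecture.R90.S8

variable (L : Type) [Field L] [NumberField L] [IsCMField L] [MeasurableSpace (quasiSplit (↥(maximalRealSubfield L)) L (IsCMField.complexConj L) 3).Adelic] [BorelSpace (quasiSplit (↥(maximalRealSubfield L)) L (IsCMField.complexConj L) 3).Adelic]


/-! ## §1 HEAD: (R)′ over rows at ADMISSIBLE generators, plus `hW1` -/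

/-- **(R)′ FROM ROWS AT ADMISSIBLE GENERATORS ONLY — `resGMidBlock ξ μω ≤ L²_res(𝔓)` AT THE SOCKET FRAME OF B ED. 7 :337.**  Binders: the socket frame verbatim; an admissibility
predicate `Adm` on generator data `(K′, ω, φ)`; L1 `hDISC` (★ p863331's `hadm` bytes); **`hW1`**: the middle block lies in the closed invariant hull (★ `ClosedSubrep.generate`) of
the `Adm`-ADMISSIBLE generators (D1's clauses with `Adm K′ ω φ` added); and ★ (R)′ OF RECORD's rows `hCONT`, `hEXP`, the F5 block (once), `hSCALrows`, `hSCATrows`, each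
restricted to `Adm`-admissible generators (one extra binder `(_ : Adm K′ ω φ)` after `φ`, otherwise byte-identical).  PROOF: `L²_res = L²_disc ⊓ (L²_cusp)ᗮ`; disc half = L1 for
the whole block; cusp half: `(L²_cusp)ᗮ` is a closed invariant subspace of the unitary `R`, so `hW1` + ★ `ClosedSubrep.generate_le` reduce it to the admissible generators, where
★ (R)′ OF RECORD's per-generator spine and the residue letters give `f ⟂ L²_cusp`.
[cite: MoeglinWaldspurger1995, I.2.17, I.2.18, IV.1.11, IV.2.3, V.3.13] [cite: Rogawski1990, §13.9 p. 229 (ii)] [cite: Langlands1976, §7] -/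
theorem res_midBlock_le_residual_of_admissible [MeasurableSpace (AdeleRing (𝓞 L) L)ˣ] [BorelSpace (AdeleRing (𝓞 L) L)ˣ]
    (μ : Measure (quasiSplit (↥(maximalRealSubfield L)) L (IsCMField.complexConj L) 3).automorphicQuotient) [(quasiSplit (↥(maximalRealSubfield L)) L (IsCMField.complexConj L) 3).IsAutomorphicMeasure μ]
    (𝔓 : (quasiSplit (↥(maximalRealSubfield L)) L (IsCMField.complexConj L) 3).ParabolicUnipotentData) (h𝔓 : ∀ j : 𝔓.ι, 𝔓.radical j = adelicUnipotent (↥(maximalRealSubfield L)) L (IsCMField.complexConj L) 3) (hne : Nonempty 𝔓.ι)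
    (μω : HeckeCharacter L) (hμu : μω.IsUnitary) (hquad : (∀ x : Literature.NumberTheory.GaloisRepresentations.ideleGroup ↥(maximalRealSubfield L), μω (AdeleRing.ideleBaseChange (↥(maximalRealSubfield L)) L x) = quadraticHeckeCharCM L x)) (ξ : OneDimAutRepH L)
    -- the ADMISSIBILITY PREDICATE on generator data `(K′, ω, φ)` (τ-admissible of S8-R199, 1-dim-admissible of S8-R197, their union, …)
    (Adm : ∀ K' : Subgroup (quasiSplit (↥(maximalRealSubfield L)) L (IsCMField.complexConj L) 3).Adelic, (↥K' →* ℂ) → ((quasiSplit (↥(maximalRealSubfield L)) L (IsCMField.complexConj L) 3).Adelic → ℂ) → Prop)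
    -- L1 at the frame
    (hDISC : ∀ (E : Submodule ℂ (resGMidBlock L μ ξ μω).toSubmodule)
          (hE : ∀ k, ∀ x ∈ E, ((resGMidBlock L μ ξ μω).toContRep.restrict (((standardMaximalCompactGL 3 L).comap (adelicVal (↥(maximalRealSubfield L)) L (IsCMField.complexConj L) 3 ((StdForm.antidiagonal 3).over L)) : Subgroup (quasiSplit (↥(maximalRealSubfield L)) L (IsCMField.complexConj L) 3).Adelic)).subtype) k x ∈ E), FiniteDimensional ℂ E →
          (((resGMidBlock L μ ξ μω).toContRep.restrict (((standardMaximalCompactGL 3 L).comap (adelicVal (↥(maximalRealSubfield L)) L (IsCMField.complexConj L) 3 ((StdForm.antidiagonal 3).over L)) : Subgroup (quasiSplit (↥(maximalRealSubfield L)) L (IsCMField.complexConj L) 3).Adelic)).subtype).subRep E hE).IsIrreducible →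
          FiniteDimensional ℂ (Representation.homRangeSum ((resGMidBlock L μ ξ μω).toContRep.restrict (((standardMaximalCompactGL 3 L).comap (adelicVal (↥(maximalRealSubfield L)) L (IsCMField.complexConj L) 3 ((StdForm.antidiagonal 3).over L)) : Subgroup (quasiSplit (↥(maximalRealSubfield L)) L (IsCMField.complexConj L) 3).Adelic)).subtype).toRepresentation (((resGMidBlock L μ ξ μω).toContRep.restrict (((standardMaximalCompactGL 3 L).comap (adelicVal (↥(maximalRealSubfield L)) L (IsCMField.complexConj L) 3 ((StdForm.antidiagonal 3).over L)) : Subgroup (quasiSplit (↥(maximalRealSubfield L)) L (IsCMField.complexConj L) 3).Adelic)).subtype).subRep E hE)))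
    -- (W1) THE ADMISSIBLE GENERATORS GENERATE: the middle block lies in the closed invariant hull of the `Adm`-ADMISSIBLE generators (D1's clauses + `Adm K′ ω φ`)
    (hW1 : resGMidBlock L μ ξ μω ≤ ClosedSubrep.generate ((quasiSplit (↥(maximalRealSubfield L)) L (IsCMField.complexConj L) 3).rightRegular μ)
        {f : (quasiSplit (↥(maximalRealSubfield L)) L (IsCMField.complexConj L) 3).L2 μ | ∃ (K' : Subgroup (quasiSplit (↥(maximalRealSubfield L)) L (IsCMField.complexConj L) 3).Adelic) (ω : ↥K' →* ℂ)
          (φ : (quasiSplit (↥(maximalRealSubfield L)) L (IsCMField.complexConj L) 3).Adelic → ℂ) (_ : Adm K' ω φ) (_ : φ ∈ chiSectionSpacePair (ξ.bcη⁻¹ * ξ.bcψ⁻¹ * μω) ξ.ψ K' (ω : ↥K' → ℂ)) (_ : Continuous φ)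
          (Ec : ℂ → (quasiSplit (↥(maximalRealSubfield L)) L (IsCMField.complexConj L) 3).Adelic → ℂ) (Sp : Finset ℂ) (_ : ∀ s ∈ Sp, s.im = 0 ∧ 1 < s.re ∧ s.re ≤ 2)
          (_ : ∀ g, DifferentiableOn ℂ (fun z => Ec z g) ({z : ℂ | 1 < z.re} \ (↑Sp : Set ℂ)))
          (_ : ∀ z : ℂ, 2 < z.re → Ec z = eisensteinSeriesU (flatSectionU φ z))
          (Fp : (quasiSplit (↥(maximalRealSubfield L)) L (IsCMField.complexConj L) 3).Adelic → ℂ → ℂ) (_ : ∀ g, AnalyticAt ℂ (Fp g) ((3 : ℂ) / 2))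
          (_ : ∀ g, Fp g =ᶠ[𝓝[≠] ((3 : ℂ) / 2)] fun z => (z - (3 : ℂ) / 2) * Ec z g),
          (f : (quasiSplit (↥(maximalRealSubfield L)) L (IsCMField.complexConj L) 3).automorphicQuotient → ℂ) =ᵐ[μ] fun x => Fp (Quotient.out (x : (quasiSplit (↥(maximalRealSubfield L)) L (IsCMField.complexConj L) 3).Adelic ⧸ (quasiSplit (↥(maximalRealSubfield L)) L (IsCMField.complexConj L) 3).quotientSubgroup))⁻¹ ((3 : ℂ) / 2)})
    -- hCONT at the frame: per ADMISSIBLE generator, every normalised Heisenberg package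
    (hCONT : ∀ (K' : Subgroup (quasiSplit (↥(maximalRealSubfield L)) L (IsCMField.complexConj L) 3).Adelic) (ω : ↥K' →* ℂ)
      (φ : (quasiSplit (↥(maximalRealSubfield L)) L (IsCMField.complexConj L) 3).Adelic → ℂ) (_ : Adm K' ω φ) (_ : φ ∈ chiSectionSpacePair (ξ.bcη⁻¹ * ξ.bcψ⁻¹ * μω) ξ.ψ K' (ω : ↥K' → ℂ)) (_ : Continuous φ)
      (Ec : ℂ → (quasiSplit (↥(maximalRealSubfield L)) L (IsCMField.complexConj L) 3).Adelic → ℂ) (Sp : Finset ℂ) (_ : ∀ s ∈ Sp, s.im = 0 ∧ 1 < s.re ∧ s.re ≤ 2)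
      (_ : ∀ g, DifferentiableOn ℂ (fun z => Ec z g) ({z : ℂ | 1 < z.re} \ (↑Sp : Set ℂ)))
      (_ : ∀ z : ℂ, 2 < z.re → Ec z = eisensteinSeriesU (flatSectionU φ z))
      (Fp : (quasiSplit (↥(maximalRealSubfield L)) L (IsCMField.complexConj L) 3).Adelic → ℂ → ℂ) (_ : ∀ g, AnalyticAt ℂ (Fp g) ((3 : ℂ) / 2))
      (_ : ∀ g, Fp g =ᶠ[𝓝[≠] ((3 : ℂ) / 2)] fun z => (z - (3 : ℂ) / 2) * Ec z g)
      (f : (quasiSplit (↥(maximalRealSubfield L)) L (IsCMField.complexConj L) 3).L2 μ) (_ : (f : (quasiSplit (↥(maximalRealSubfield L)) L (IsCMField.complexConj L) 3).automorphicQuotient → ℂ) =ᵐ[μ] fun x => Fp (Quotient.out (x : (quasiSplit (↥(maximalRealSubfield L)) L (IsCMField.complexConj L) 3).Adelic ⧸ (quasiSplit (↥(maximalRealSubfield L)) L (IsCMField.complexConj L) 3).quotientSubgroup))⁻¹ ((3 : ℂ) / 2))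
      (ν : Measure ↥(adelicUnipotent (↥(maximalRealSubfield L)) L (IsCMField.complexConj L) 3)) (_ : ν.IsHaarMeasure) (𝓕 : Set ↥(adelicUnipotent (↥(maximalRealSubfield L)) L (IsCMField.complexConj L) 3)) (_ : IsFundamentalDomain ↥(rationalUnipotent (↥(maximalRealSubfield L)) L (IsCMField.complexConj L) 3) 𝓕 ν) (_ : IsCompact (closure 𝓕)) (_ : ν.IsInvInvariant) (_ : ν 𝓕 = 1),
      ∃ (T : ℝ≥0) (_ : 1 ≤ T) (S : Finset ℂ) (_ : ∀ s ∈ S, s.im = 0) (Fam : ℂ → (quasiSplit (↥(maximalRealSubfield L)) L (IsCMField.complexConj L) 3).L2 μ),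
        DifferentiableOn ℂ Fam ({z : ℂ | 1 < z.re} \ (↑(Sp ∪ S) : Set ℂ)) ∧
        ∀ z ∈ ({z : ℂ | 1 < z.re} \ (↑(Sp ∪ S) : Set ℂ)), ((Fam z : (quasiSplit (↥(maximalRealSubfield L)) L (IsCMField.complexConj L) 3).L2 μ) : (quasiSplit (↥(maximalRealSubfield L)) L (IsCMField.complexConj L) 3).automorphicQuotient → ℂ) =ᵐ[μ] (quasiSplit (↥(maximalRealSubfield L)) L (IsCMField.complexConj L) 3).quotFun (truncation ν 𝓕 T (Ec z)))
    -- (V) (i): the exports' LAYER-2 rows, per ADMISSIBLE generator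
    (hEXP : ∀ (K' : Subgroup (quasiSplit (↥(maximalRealSubfield L)) L (IsCMField.complexConj L) 3).Adelic) (ω : ↥K' →* ℂ)
      (φ : (quasiSplit (↥(maximalRealSubfield L)) L (IsCMField.complexConj L) 3).Adelic → ℂ) (_ : Adm K' ω φ) (_ : φ ∈ chiSectionSpacePair (ξ.bcη⁻¹ * ξ.bcψ⁻¹ * μω) ξ.ψ K' (ω : ↥K' → ℂ)) (_ : Continuous φ)
      (Ec : ℂ → (quasiSplit (↥(maximalRealSubfield L)) L (IsCMField.complexConj L) 3).Adelic → ℂ) (Sp : Finset ℂ) (_ : ∀ s ∈ Sp, s.im = 0 ∧ 1 < s.re ∧ s.re ≤ 2)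
      (_ : ∀ g, DifferentiableOn ℂ (fun z => Ec z g) ({z : ℂ | 1 < z.re} \ (↑Sp : Set ℂ)))
      (_ : ∀ z : ℂ, 2 < z.re → Ec z = eisensteinSeriesU (flatSectionU φ z))
      (Fp : (quasiSplit (↥(maximalRealSubfield L)) L (IsCMField.complexConj L) 3).Adelic → ℂ → ℂ) (_ : ∀ g, AnalyticAt ℂ (Fp g) ((3 : ℂ) / 2))
      (_ : ∀ g, Fp g =ᶠ[𝓝[≠] ((3 : ℂ) / 2)] fun z => (z - (3 : ℂ) / 2) * Ec z g)
      (f : (quasiSplit (↥(maximalRealSubfield L)) L (IsCMField.complexConj L) 3).L2 μ) (_ : (f : (quasiSplit (↥(maximalRealSubfield L)) L (IsCMField.complexConj L) 3).automorphicQuotient → ℂ) =ᵐ[μ] fun x => Fp (Quotient.out (x : (quasiSplit (↥(maximalRealSubfield L)) L (IsCMField.complexConj L) 3).Adelic ⧸ (quasiSplit (↥(maximalRealSubfield L)) L (IsCMField.complexConj L) 3).quotientSubgroup))⁻¹ ((3 : ℂ) / 2)), (∀ z ∈ ({z : ℂ | 1 < z.re} \ (↑Sp : Set ℂ)), Continuous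 (Ec z)) ∧ (∀ z₁ ∈ ({z : ℂ | 1 < z.re} \ (↑Sp : Set ℂ)), ∀ K : Set (quasiSplit (↥(maximalRealSubfield L)) L (IsCMField.complexConj L) 3).Adelic, IsCompact K → ∃ V ∈ 𝓝 z₁, ∃ M : ℝ, ∀ z ∈ V, ∀ g ∈ K, ‖Ec z g‖ ≤ M))
    -- (V) (iii): the F5 scalar rows at `φ := ξ.bcη⁻¹ * μω`, `η := 1`, ONCE
    {S : Set (HeightOneSpectrum (𝓞 L))} {T' : Set (HeightOneSpectrum (𝓞 ↥(maximalRealSubfield L)))}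
    (hS : S.Finite) (hurφ : ∀ w ∉ S, (ξ.bcη⁻¹ * μω).IsUnramifiedAt w) (hT' : T'.Finite) (hurη : ∀ v ∉ T', (1 : HeckeCharacter ↥(maximalRealSubfield L)).IsUnramifiedAt v)
    (q qc : ℂ → ℂ) {P : Set ℂ} (hqcq : ∀ z : ℂ, 2 < z.re → qc z = q z) (hPcd : ∀ z₀ : ℂ, ∀ᶠ s in 𝓝[≠] z₀, s ∉ P) (hqa : ∀ z : ℂ, z ∉ P → AnalyticAt ℂ qc z)
    (A : ℂ → ℂ) (hA : DifferentiableOn ℂ A {z : ℂ | 1 < z.re})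
    (hsrc : ∀ z : ℂ, 2 < z.re → q z = A z *
          ((partialStandardL S (fun w => {(ξ.bcη⁻¹ * μω).valueAtUniformizer w}) (z - 1) * partialStandardL T' (fun v => {(1 : HeckeCharacter ↥(maximalRealSubfield L)).valueAtUniformizer v}) (2 * z - 2)) /
            (partialStandardL S (fun w => {(ξ.bcη⁻¹ * μω).valueAtUniformizer w}) z * partialStandardL T' (fun v => {(1 : HeckeCharacter ↥(maximalRealSubfield L)).valueAtUniformizer v}) (2 * z - 1))))
    (hA32 : A (3 / 2) ≠ 0) (cS : ℂ → ℂ) (hq : ∀ z : ℂ, 2 < z.re → q z = A z * cS z)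
    -- J-S8-SCAL: the unfolding + profile rows, per ADMISSIBLE generator
    (hSCALrows : ∀ (K' : Subgroup (quasiSplit (↥(maximalRealSubfield L)) L (IsCMField.complexConj L) 3).Adelic) (ω : ↥K' →* ℂ)
      (φ : (quasiSplit (↥(maximalRealSubfield L)) L (IsCMField.complexConj L) 3).Adelic → ℂ) (_ : Adm K' ω φ) (_ : φ ∈ chiSectionSpacePair (ξ.bcη⁻¹ * ξ.bcψ⁻¹ * μω) ξ.ψ K' (ω : ↥K' → ℂ)) (_ : Continuous φ)
      (Ec : ℂ → (quasiSplit (↥(maximalRealSubfield L)) L (IsCMField.complexConj L) 3).Adelic → ℂ) (Sp : Finset ℂ) (_ : ∀ s ∈ Sp, s.im = 0 ∧ 1 < s.re ∧ s.re ≤ 2)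
      (_ : ∀ g, DifferentiableOn ℂ (fun z => Ec z g) ({z : ℂ | 1 < z.re} \ (↑Sp : Set ℂ)))
      (_ : ∀ z : ℂ, 2 < z.re → Ec z = eisensteinSeriesU (flatSectionU φ z))
      (Fp : (quasiSplit (↥(maximalRealSubfield L)) L (IsCMField.complexConj L) 3).Adelic → ℂ → ℂ) (_ : ∀ g, AnalyticAt ℂ (Fp g) ((3 : ℂ) / 2))
      (_ : ∀ g, Fp g =ᶠ[𝓝[≠] ((3 : ℂ) / 2)] fun z => (z - (3 : ℂ) / 2) * Ec z g)
      (f : (quasiSplit (↥(maximalRealSubfield L)) L (IsCMField.complexConj L) 3).L2 μ) (_ : (f : (quasiSplit (↥(maximalRealSubfield L)) L (IsCMField.complexConj L) 3).automorphicQuotient → ℂ) =ᵐ[μ] fun x => Fp (Quotient.out (x : (quasiSplit (↥(maximalRealSubfield L)) L (IsCMField.complexConj L) 3).Adelic ⧸ (quasiSplit (↥(maximalRealSubfield L)) L (IsCMField.complexConj L) 3).quotientSubgroup))⁻¹ ((3 : ℂ) / 2))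
      (ν : Measure ↥(adelicUnipotent (↥(maximalRealSubfield L)) L (IsCMField.complexConj L) 3)) (_ : ν.IsHaarMeasure) (𝓕 : Set ↥(adelicUnipotent (↥(maximalRealSubfield L)) L (IsCMField.complexConj L) 3)) (_ : IsFundamentalDomain ↥(rationalUnipotent (↥(maximalRealSubfield L)) L (IsCMField.complexConj L) 3) 𝓕 ν) (_ : IsCompact (closure 𝓕)) (_ : ν.IsInvInvariant) (_ : ν 𝓕 = 1),
      ∃ (Ag : (quasiSplit (↥(maximalRealSubfield L)) L (IsCMField.complexConj L) 3).Adelic → ℂ → ℂ) (M : ℝ),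
        (∀ g, DifferentiableOn ℂ (Ag g) {z : ℂ | 1 < z.re}) ∧ (∀ g, ‖Ag g (3 / 2)‖ ≤ M) ∧
        (∀ z : ℂ, 2 < z.re → ∀ g : (quasiSplit (↥(maximalRealSubfield L)) L (IsCMField.complexConj L) 3).Adelic, (borelConstantTerm ν 𝓕 (Ec z) g - φ g * (((borelHeight g : ℝ≥0) : ℝ) : ℂ) ^ z) / (((borelHeight g : ℝ≥0) : ℝ) : ℂ) ^ (2 - z) = Ag g z * cS z) ∧
        (Measurable fun g : (quasiSplit (↥(maximalRealSubfield L)) L (IsCMField.complexConj L) 3).Adelic => Ag g ((3 : ℂ) / 2)) ∧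
        (∀ b ∈ arithmeticBorel (↥(maximalRealSubfield L)) L (IsCMField.complexConj L) 3, ∀ x : (quasiSplit (↥(maximalRealSubfield L)) L (IsCMField.complexConj L) 3).Adelic, Ag ((b : (quasiSplit (↥(maximalRealSubfield L)) L (IsCMField.complexConj L) 3).Adelic) * x) ((3 : ℂ) / 2) = Ag x ((3 : ℂ) / 2)) ∧
        (∀ (u : ↥(adelicUnipotent (↥(maximalRealSubfield L)) L (IsCMField.complexConj L) 3)) (g : (quasiSplit (↥(maximalRealSubfield L)) L (IsCMField.complexConj L) 3).Adelic), Ag ((u : (quasiSplit (↥(maximalRealSubfield L)) L (IsCMField.complexConj L) 3).Adelic) * g) ((3 : ℂ) / 2) = Ag g ((3 : ℂ) / 2)))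
    -- hSCAT's rows, per ADMISSIBLE generator
    (hSCATrows : ∀ (K' : Subgroup (quasiSplit (↥(maximalRealSubfield L)) L (IsCMField.complexConj L) 3).Adelic) (ω : ↥K' →* ℂ)
      (φ : (quasiSplit (↥(maximalRealSubfield L)) L (IsCMField.complexConj L) 3).Adelic → ℂ) (_ : Adm K' ω φ) (_ : φ ∈ chiSectionSpacePair (ξ.bcη⁻¹ * ξ.bcψ⁻¹ * μω) ξ.ψ K' (ω : ↥K' → ℂ)) (_ : Continuous φ)
      (Ec : ℂ → (quasiSplit (↥(maximalRealSubfield L)) L (IsCMField.complexConj L) 3).Adelic → ℂ) (Sp : Finset ℂ) (_ : ∀ s ∈ Sp, s.im = 0 ∧ 1 < s.re ∧ s.re ≤ 2)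
      (_ : ∀ g, DifferentiableOn ℂ (fun z => Ec z g) ({z : ℂ | 1 < z.re} \ (↑Sp : Set ℂ)))
      (_ : ∀ z : ℂ, 2 < z.re → Ec z = eisensteinSeriesU (flatSectionU φ z))
      (Fp : (quasiSplit (↥(maximalRealSubfield L)) L (IsCMField.complexConj L) 3).Adelic → ℂ → ℂ) (_ : ∀ g, AnalyticAt ℂ (Fp g) ((3 : ℂ) / 2))
      (_ : ∀ g, Fp g =ᶠ[𝓝[≠] ((3 : ℂ) / 2)] fun z => (z - (3 : ℂ) / 2) * Ec z g)
      (f : (quasiSplit (↥(maximalRealSubfield L)) L (IsCMField.complexConj L) 3).L2 μ) (_ : (f : (quasiSplit (↥(maximalRealSubfield L)) L (IsCMField.complexConj L) 3).automorphicQuotient → ℂ) =ᵐ[μ] fun x => Fp (Quotient.out (x : (quasiSplit (↥(maximalRealSubfield L)) L (IsCMField.complexConj L) 3).Adelic ⧸ (quasiSplit (↥(maximalRealSubfield L)) L (IsCMField.complexConj L) 3).quotientSubgroup))⁻¹ ((3 : ℂ) / 2))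
      (ν : Measure ↥(adelicUnipotent (↥(maximalRealSubfield L)) L (IsCMField.complexConj L) 3)) (_ : ν.IsHaarMeasure) (𝓕 : Set ↥(adelicUnipotent (↥(maximalRealSubfield L)) L (IsCMField.complexConj L) 3)) (_ : IsFundamentalDomain ↥(rationalUnipotent (↥(maximalRealSubfield L)) L (IsCMField.complexConj L) 3) 𝓕 ν) (_ : IsCompact (closure 𝓕)) (_ : ν.IsInvInvariant) (_ : ν 𝓕 = 1),
      ∃ (ι : Type) (_ : Fintype ι) (φ' : ι → (quasiSplit (↥(maximalRealSubfield L)) L (IsCMField.complexConj L) 3).Adelic → ℂ) (qv qcv : ι → ℂ → ℂ) (P' : Set ℂ) (r : ι → ℂ → ℂ),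
        (∀ j, Continuous (φ' j)) ∧ (∀ j, ∃ C : ℝ, ∀ x, ‖φ' j x‖ ≤ C) ∧
        (∀ z : ℂ, 2 < z.re → (∑ j, qv j z • φ' j) = ((((ν 𝓕).toReal⁻¹ : ℝ)) : ℂ) • (fun g : (quasiSplit (↥(maximalRealSubfield L)) L (IsCMField.complexConj L) 3).Adelic => (∫ v : ↥(adelicUnipotent (↥(maximalRealSubfield L)) L (IsCMField.complexConj L) 3), flatSectionU φ z ((quasiSplit (↥(maximalRealSubfield L)) L (IsCMField.complexConj L) 3).toAdelic (weylLongU ((IsCMField.complexConj L : L ≃ₐ[↥(maximalRealSubfield L)] L) : L →+* L) (rfl : (StdForm.antidiagonal 3).over L = (StdForm.antidiagonal 3).over L)) * ((v : (quasiSplit (↥(maximalRealSubfield L)) L (IsCMField.complexConj L) 3).Adelic) * g)) ∂ν) * (((borelHeight g : ℝ) : ℂ) ^ (z - 2)))) ∧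
        (∀ j, DifferentiableOn ℂ (qcv j) P'ᶜ) ∧ (∀ j (z : ℂ), 2 < z.re → qcv j z = qv j z) ∧ (∀ z ∈ P', z.im = 0) ∧
        (∀ j, AnalyticAt ℂ (r j) (3 / 2 : ℂ)) ∧ (∀ j, ∀ᶠ z in 𝓝[≠] ((3 / 2 : ℂ)), qcv j z = qc z * r j z) ∧
        (∀ (μK : Measure ↥((standardMaximalCompactGL 3 L).comap (adelicVal (↥(maximalRealSubfield L)) L (IsCMField.complexConj L) 3 ((StdForm.antidiagonal 3).over L)) : Subgroup (quasiSplit (↥(maximalRealSubfield L)) L (IsCMField.complexConj L) 3).Adelic)) (_ : μK.IsHaarMeasure) (νI : Measure (AdeleRing (𝓞 L) L)ˣ) (_ : νI.IsHaarMeasure) (𝓕I : Set (AdeleRing (𝓞 L) L)ˣ) (_ : IsIdeleClassDomain L 𝓕I) (wc : ℂ → ℂ),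
          (∀ z : ℂ, wc z = (∑ j, qcv j z * ∫ k, φ' j (k : (quasiSplit (↥(maximalRealSubfield L)) L (IsCMField.complexConj L) 3).Adelic) * conj (φ (k : (quasiSplit (↥(maximalRealSubfield L)) L (IsCMField.complexConj L) 3).Adelic)) ∂μK) * ∫ x in {x : (AdeleRing (𝓞 L) L)ˣ | (IdeleClassGroup.ideleNorm L x : ℝ) ≤ 1} ∩ 𝓕I, ((IdeleClassGroup.ideleNorm L x : ℝ) : ℂ) * (((reflectChar (IsCMField.complexConj L) (ξ.bcη⁻¹ * ξ.bcψ⁻¹ * μω) x : ℂˣ) : ℂ) * conj (((ξ.bcη⁻¹ * ξ.bcψ⁻¹ * μω) x : ℂˣ) : ℂ)) ∂νI) → ∀ᶠ x : ℝ in 𝓝[≠] (3 / 2 : ℝ), (wc (x : ℂ)).im = 0)) :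
    resGMidBlock L μ ξ μω ≤ residualSubspace (quasiSplit (↥(maximalRealSubfield L)) L (IsCMField.complexConj L) 3) μ 𝔓 := by
  -- the scalar residue `ρ` (★ F5) and the removable singularity `d₀ = (z − 3∕2)·qc` (★), once
  obtain ⟨ρ, hρ, -⟩ := exists_residue_at_threeHalves_cm_three L (isUnitary_bcηInv_mul L ξ hμu) (bcηInv_mul_posRealIdele L ξ μω hquad) hS hurφ
    (heckeChar_one_isUnitary ↥(maximalRealSubfield L)) (heckeChar_one_posRealIdele ↥(maximalRealSubfield L)) hT' hurη q qc hqcq hPcd hqa A hA hsrc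
  obtain ⟨d₀, hd₀, hd₀q, -⟩ := exists_analyticAt_eventuallyEq_mul_sub_of_tendsto (eventually_nhdsWithin_iff.1 (hPcd ((3 : ℂ) / 2)))
    (fun x hx => (hqa x (hx.1 hx.2)).differentiableAt.differentiableWithinAt) hρ
  -- a NORMALISED Heisenberg package (★ inhabited, rescaled by `(ν 𝓕)⁻¹` as in ★ p863731 §2)
  obtain ⟨ν, 𝓕, hν, hinv, h𝓕N, h𝓕c, h𝓕1⟩ : ∃ (ν : Measure ↥(adelicUnipotent (↥(maximalRealSubfield L)) L (IsCMField.complexConj L) 3)) (𝓕 : Set ↥(adelicUnipotent (↥(maximalRealSubfield L)) L (IsCMField.complexConj L) 3)), ν.IsHaarMeasure ∧ ν.IsInvInvariant ∧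
      IsFundamentalDomain ↥(rationalUnipotent (↥(maximalRealSubfield L)) L (IsCMField.complexConj L) 3) 𝓕 ν ∧ IsCompact (closure 𝓕) ∧ ν 𝓕 = 1 := by
    obtain ⟨ν, 𝓕, hν, -, -, h𝓕N, h𝓕c, h𝓕0, h𝓕top⟩ :=
      Summit.HodgeConjecture.HodgeConjecture.Cruxes.H413.K2E1SphericalEisensteinStructuralDataCMThree.exists_unipotent_haar_fundamentalDomain_cm_three L
    haveI := hν
    have hc : IsCMField.complexConj L * IsCMField.complexConj L = 1 := AlgEquiv.ext fun x => IsCMField.complexConj_apply_apply L x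
    haveI hν₁ : ((ν 𝓕)⁻¹ • ν).IsHaarMeasure := Measure.IsHaarMeasure.smul ν (ENNReal.inv_ne_zero.2 h𝓕top) (ENNReal.inv_ne_top.2 h𝓕0)
    exact ⟨(ν 𝓕)⁻¹ • ν, 𝓕, hν₁, Summit.HodgeConjecture.HodgeConjecture.Cruxes.H413.K2E1HeisenbergHaarU3.isInvInvariant_of_isHaarMeasure_adelicUnipotent_three hc _,
      h𝓕N.mono smul_absolutelyContinuous, h𝓕c, by rw [Measure.smul_apply, smul_eq_mul, ENNReal.inv_mul_cancel h𝓕0 h𝓕top]⟩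
  haveI := hν
  haveI := hinv
  obtain ⟨i⟩ := hne
  -- `L²_res = L²_disc ⊓ (L²_cusp)ᗮ`: the disc half for the WHOLE block is L1 (★ `resGMidBlock_le_discreteSpectrum_of_admissible`); the cusp half passes from the admissible
  -- generators to their closed invariant hull because `(L²_cusp)ᗮ` is a CLOSED INVARIANT subspace of the unitary `R` (★ `ClosedSubrep.orthogonal`, ★ `ClosedSubrep.generate_le`) — then `hW1`
  have hdisc := resGMidBlock_le_discreteSpectrum_of_admissible L μ ξ μω hDISC
  intro f₀ hf₀
  rw [residualSubspace, mem_residualPart_iff]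
  have hu := (quasiSplit (↥(maximalRealSubfield L)) L (IsCMField.complexConj L) 3).isUnitary_rightRegular μ
  refine ⟨hdisc hf₀, (ClosedSubrep.mem_orthogonal_iff hu _ f₀).1
    (ClosedSubrep.generate_le (W := ((quasiSplit (↥(maximalRealSubfield L)) L (IsCMField.complexConj L) 3).cuspidalSubspace μ 𝔓).orthogonal hu) ?_ (hW1 hf₀))⟩
  rintro f ⟨K', ω, φ, hAdm, hφV, hφc, Ec, Sp, hSp, hhol, hEis, Fp, hFp, hFpE, hf⟩
  -- ONE ADMISSIBLE GENERATOR `f`: its rows at the normalised package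
  obtain ⟨T, hT, S₁, hS₁, Fam, hFd, hFam⟩ := hCONT K' ω φ hAdm hφV hφc Ec Sp hSp hhol hEis Fp hFp hFpE f hf ν hν 𝓕 h𝓕N h𝓕c hinv h𝓕1
  obtain ⟨hE4, hEbd⟩ := hEXP K' ω φ hAdm hφV hφc Ec Sp hSp hhol hEis Fp hFp hFpE f hf
  obtain ⟨Ag, M, hAg, hM, hψ2, hAgm, hAgB, hAgN⟩ := hSCALrows K' ω φ hAdm hφV hφc Ec Sp hSp hhol hEis Fp hFp hFpE f hf ν hν 𝓕 h𝓕N h𝓕c hinv h𝓕1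
  obtain ⟨ι, hι, φ', qv, qcv, P', r, hφ'c, hφ'bd, hqφ, hqcP, hqcq', hPreal, hr, hfacv, hreal⟩ :=
    hSCATrows K' ω φ hAdm hφV hφc Ec Sp hSp hhol hEis Fp hFp hFpE f hf ν hν 𝓕 h𝓕N h𝓕c hinv h𝓕1
  obtain ⟨Cφ, hφC⟩ := exists_bound_of_mem_chiSectionSpacePair_midBlock L ξ hμu hφV hφc
  -- hSCAT's package for every `(μ_K, ν_I, 𝓕_I)`: ★ p863697 §2 on the quarter planes (⊆ `P′ᶜ` because `P′` is real), Gram ★ §4, `hreal` the row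
  have hDUPo : IsOpen {z : ℂ | 1 < z.re ∧ 0 < z.im} := (isOpen_lt continuous_const Complex.continuous_re).and (isOpen_lt continuous_const Complex.continuous_im)
  have hDLOo : IsOpen {z : ℂ | 1 < z.re ∧ z.im < 0} := (isOpen_lt continuous_const Complex.continuous_re).and (isOpen_lt Complex.continuous_im continuous_const)
  have hscat : ∀ (μK : Measure ↥((standardMaximalCompactGL 3 L).comap (adelicVal (↥(maximalRealSubfield L)) L (IsCMField.complexConj L) 3 ((StdForm.antidiagonal 3).over L)) : Subgroup (quasiSplit (↥(maximalRealSubfield L)) L (IsCMField.complexConj L) 3).Adelic)) (_ : μK.IsHaarMeasure) (νI : Measure (AdeleRing (𝓞 L) L)ˣ) (_ : νI.IsHaarMeasure) (𝓕I : Set (AdeleRing (𝓞 L) L)ˣ) (_ : IsIdeleClassDomain L 𝓕I),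
        ∃ (wc : ℂ → ℂ) (Bc : ℂ → ℂ → ℂ) (d : ℂ → ℂ),
          DifferentiableOn ℂ wc {z : ℂ | 1 < z.re ∧ 0 < z.im} ∧ DifferentiableOn ℂ wc {z : ℂ | 1 < z.re ∧ z.im < 0} ∧ (∀ s : ℂ, 2 < s.re → wc s = ∫ x in {x : (AdeleRing (𝓞 L) L)ˣ | (IdeleClassGroup.ideleNorm L x : ℝ) ≤ 1} ∩ 𝓕I, ((IdeleClassGroup.ideleNorm L x : ℝ) : ℂ) * (((reflectChar (IsCMField.complexConj L) (ξ.bcη⁻¹ * ξ.bcψ⁻¹ * μω) x : ℂˣ) : ℂ) * conj (((ξ.bcη⁻¹ * ξ.bcψ⁻¹ * μω) x : ℂˣ) : ℂ) * (∫ k, (fun g : (quasiSplit (↥(maximalRealSubfield L)) L (IsCMField.complexConj L) 3).Adelic => (∫ v : ↥(adelicUnipotent (↥(maximalRealSubfield L)) L (IsCMField.complexConj L) 3), flatSectionU φ s ((quasiSplit (↥(maximalRealSubfield L)) L (IsCMField.complexConj L) 3).toAdelic (weylLongU ((IsCMField.complexConj L : L ≃ₐ[↥(maximalRealSubfield L)]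 L) : L →+* L) (rfl : (StdForm.antidiagonal 3).over L = (StdForm.antidiagonal 3).over L)) * ((v : (quasiSplit (↥(maximalRealSubfield L)) L (IsCMField.complexConj L) 3).Adelic) * g)) ∂ν) * ((borelHeight g : ℝ) : ℂ) ^ (s - 2)) (k : (quasiSplit (↥(maximalRealSubfield L)) L (IsCMField.complexConj L) 3).Adelic) * conj (φ (k : (quasiSplit (↥(maximalRealSubfield L)) L (IsCMField.complexConj L) 3).Adelic)) ∂μK)) ∂νI) ∧
          (∀ z' ∈ {z : ℂ | 1 < z.re ∧ 0 < z.im}, DifferentiableOn ℂ (fun z : ℂ => Bc z z') {z : ℂ | 1 < z.re ∧ 0 < z.im}) ∧ (∀ z ∈ {z : ℂ | 1 < z.re ∧ 0 < z.im}, DifferentiableOn ℂ (fun u : ℂ => Bc z (conj u)) {u : ℂ | conj u ∈ {z : ℂ | 1 < z.re ∧ 0 < z.im}}) ∧ (∀ z' ∈ {z : ℂ | 1 < z.re ∧ z.im < 0}, DifferentiableOn ℂ (fun z : ℂ => Bc z z') {z : ℂ | 1 < z.re ∧ z.im < 0}) ∧ (∀ z ∈ {z : ℂ | 1 < z.re ∧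 z.im < 0}, DifferentiableOn ℂ (fun u : ℂ => Bc z (conj u)) {u : ℂ | conj u ∈ {z : ℂ | 1 < z.re ∧ z.im < 0}}) ∧ (∀ s s' : ℂ, 2 < s.re → 2 < s'.re → Bc s s' = (∫ x in {x : (AdeleRing (𝓞 L) L)ˣ | (IdeleClassGroup.ideleNorm L x : ℝ) ≤ 1} ∩ 𝓕I, ((IdeleClassGroup.ideleNorm L x : ℝ) : ℂ) ∂νI) * (∫ k, (fun g : (quasiSplit (↥(maximalRealSubfield L)) L (IsCMField.complexConj L) 3).Adelic => (∫ v : ↥(adelicUnipotent (↥(maximalRealSubfield L)) L (IsCMField.complexConj L) 3), flatSectionU φ s ((quasiSplit (↥(maximalRealSubfield L)) L (IsCMField.complexConj L) 3).toAdelic (weylLongU ((IsCMField.complexConj L : L ≃ₐ[↥(maximalRealSubfield L)] L) : L →+* L) (rfl : (StdForm.antidiagonal 3).over L = (StdForm.antidiagonal 3).over L)) * ((v : (quasiSplit (↥(maximalRealSubfield L)) L (IsCMField.complexConj L) 3).Adelic) * g)) ∂ν) * ((borelHeight g : ℝ) : ℂ) ^ (s - 2)) (k : (quasiSplit (↥(maximalRealSubfield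 L)) L (IsCMField.complexConj L) 3).Adelic) * conj ((fun g : (quasiSplit (↥(maximalRealSubfield L)) L (IsCMField.complexConj L) 3).Adelic => (∫ v : ↥(adelicUnipotent (↥(maximalRealSubfield L)) L (IsCMField.complexConj L) 3), flatSectionU φ s' ((quasiSplit (↥(maximalRealSubfield L)) L (IsCMField.complexConj L) 3).toAdelic (weylLongU ((IsCMField.complexConj L : L ≃ₐ[↥(maximalRealSubfield L)] L) : L →+* L) (rfl : (StdForm.antidiagonal 3).over L = (StdForm.antidiagonal 3).over L)) * ((v : (quasiSplit (↥(maximalRealSubfield L)) L (IsCMField.complexConj L) 3).Adelic) * g)) ∂ν) * ((borelHeight g : ℝ) : ℂ) ^ (s' - 2)) (k : (quasiSplit (↥(maximalRealSubfield L)) L (IsCMField.complexConj L) 3).Adelic)) ∂μK)) ∧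
          (AnalyticAt ℂ d (3 / 2 : ℂ)) ∧ (∀ᶠ z in 𝓝[≠] ((3 / 2 : ℂ)), d z = (z - 3 / 2) * wc z) ∧ (∀ᶠ x : ℝ in 𝓝[≠] (3 / 2 : ℝ), (wc (x : ℂ)).im = 0) ∧ (∃ B : ℝ, ∀ᶠ z in 𝓝[≠] ((3 / 2 : ℂ)), ‖z - 3 / 2‖ ^ 2 * ‖Bc z z‖ ≤ B) := by
    intro μK hμK νI hνI 𝓕I h𝓕I
    haveI := hμK
    obtain ⟨wc, Bc, d, h1, h2, h3, h4, h5, h6, h7, h8, h9, h10, h11, h12⟩ :=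
      exists_hSCAT_of_factorisation L μK νI 𝓕I ν h𝓕1 (ξ.bcη⁻¹ * ξ.bcψ⁻¹ * μω) φ φ' hqφ hqcP hqcq'
        hDUPo (fun z hz hP => hz.2.ne' (hPreal z hP)) hDLOo (fun z hz hP => hz.2.ne (hPreal z hP))
        (fun j => by obtain ⟨C, hC⟩ := hφ'bd j; exact integrable_restrict_mul_conj_of_bounded L μK (hφ'c j) hφc hC hφC)
        (fun j l => by obtain ⟨C, hC⟩ := hφ'bd j; obtain ⟨C', hC'⟩ := hφ'bd l; exact integrable_restrict_mul_conj_of_bounded L μK (hφ'c j) (hφ'c l) hC hC')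
        hr hd₀ hd₀q hfacv
    exact ⟨wc, Bc, d, h1, h2, h3, h4, h5, h6, h7, h8, h9, h10, hreal μK hμK νI hνI 𝓕I h𝓕I wc h12, h11⟩
  -- ROAD (★ p863731 §1), SCAL (§1), CT (★ p863518 §1), operator road (★ p863422 §1)
  obtain ⟨T', hT', D, σ₀, Fam', hDo, hDc, hDsub, hFd', hσ₀, hσD, hD32, hFam', hMS⟩ :=
    roadData_of_tubeLetters L μ ξ μω hμu hquad hφV hφc Ec hSp hEis ν h𝓕N h𝓕1 h𝓕c hT hS₁ Fam hFd hFam hscat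
  obtain ⟨qc', φt, hfacCT, ⟨ρ', hρ'⟩, hφt, hφtm, hφtB, hφtN, C, hφtbd⟩ :=
    scalPackage_of_inputs L φ Ec Sp hhol hE4 hEbd ν h𝓕N h𝓕c q qc hqcq hPcd hqa hρ A hA hA32 cS hq Ag hAg hM hψ2 hAgm hAgB hAgN
  obtain ⟨φ₀, ψ, ρψ, hE3, hψ, hψm, hψB, hψN, K, hψK⟩ :=
    ctPackage_of_scalarRoad L φ Ec Sp ν 𝓕 qc' φt hfacCT hρ' hφt hφtm hφtB hφtN hφtbd
  -- the operator road (★ p863422 §1) and the residue letters ⟹ `f ⟂` every cusp form (★ `hseed_of_resGMidAtomGen_clauses`, ★ `inner_cuspFormsToLp_eq_zero_of_midResidue_letters`) ⟹ `f ∈ (L²_cusp)ᗮ`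
  obtain ⟨T₂, hT₂, D₂, σ₂, Fam₂, corr, hDo₂, hDc₂, hFd₂, hσ₂, hσD₂, hD32₂, hFam₂, hlim, hcorr⟩ :=
    opRoadPackage_of_letters L μ 𝔓 ξ μω i (h𝔓 i) hφV Ec hSp hhol hEis Fp hFp hFpE f hf ν h𝓕N h𝓕c hT' Fam' hDo hDc hDsub hFd' hσ₀ hσD hD32 hFam' hMS
      φ₀ ψ ρψ hE3 hψ hψm hψB hψN hψK
  exact (ClosedSubrep.mem_orthogonal_iff hu _ f).2 (inner_eq_zero_of_mem_cuspidalSubspace_of_forall_cuspFormsToLp L μ 𝔓 f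
    (inner_cuspFormsToLp_eq_zero_of_midResidue_letters L μ 𝔓 Fam₂ hDo₂ hDc₂ hFd₂ hσ₂ hσD₂ hD32₂
      (hseed_of_resGMidAtomGen_clauses L μ ν h𝓕N h𝓕c 𝔓 i (h𝔓 i) ξ hμu hφV hφc Ec hEis hT₂ D₂ Fam₂ hFam₂) f corr hlim hcorr))

end Summit.HodgeConjecture.HodgeConjecture.R90.S8

end
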